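import Mathlib
import HarnessLib
import Summits.NavierStokesRegularity.NavierStokesRegularity.Theorems.PoloidalWindowDoorLrcModEntireQ4SonicHotSheet
import Summits.NavierStokesRegularity.NavierStokesRegularity.Theorems.PoloidalWindowDoorLrcModEntireTwistingTHFlatRidgeMixedPin
import Summits.NavierStokesRegularity.NavierStokesRegularity.Theorems.PoloidalWindowDoorLrcModEntireTwistingTHHotPointPins
import Summits.NavierStokesRegularity.NavierStokesRegularity.Theorems.PoloidalWindowDoorLrcModEntireCurvedWebHuygens

/-!
# Route `PoloidalWindowDoor`, item `LrcModEntire` (stmt-NavierStokesRegularity-20428), cell (Q4-sonic) of the (TH) column —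
# SECOND-ORDER PINS ON THE HOT SHEET (any branch shape): time–time pin, sheet tangents in the Hessian kernel, mixed time pin along the sheet,
# vanishing vorticity and the signed vertical pressure gradient at every web point

Cell ns-regularity-ideate, helper seat ns-k2-port-2 g8 under the LEAD of item 20428 (ns-poloidal-K2-p3 g16, pick 2026-08-29T17:01Z «HS1′»);
`--supports stmt-NavierStokesRegularity-20428 --as helper`.  Memo `Cruxes/LrcModEntire/T2B-g16-sonic.md` §2(b)+(c)(ii) in kernel form — the items NOT
carried by the LEAD's first-order file `…Q4SonicHotSheetPins`.  In the SONIC cell every web point `W` is a hot point (`…Q4SonicHotSheet.sonic_web_point_hot`: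
`σU₂(−1,W) = |N|`, the global maximum of `σU₂(−1,·)`), so the tree's hot-point pins apply at `W` BY NAME:

* Part A (class-free): `fderiv_fderiv_apply_eq_zero_of_critical_sheet` — if `Dθ ∘ W` vanishes near `p` then `D²θ(W p)[DW(p)h, w] = 0`;
  `hessian_sheetTangent_eq_zero` — a `C²` function `θ ≤ M` with `θ ∘ W ≡ M` near `p` has every sheet tangent `DW(p)h` in the kernel of `D²θ(W p)`
  (both slots); `fderiv_fderiv_const_mul_apply` — `D²(cθ) = c·D²θ` entrywise; `hessian_curvedWebTangent_eq_zero` — the same along K2-p2's curved web map `W(s,z) = Γ(s) + G(s,z)·JΓ′(s) + z·e₂`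
  (`…CurvedWebHuygens.fderiv_curvedWeb_apply`: tangents `(1 − kG)Γ′ + G_s JΓ′` and `G_z JΓ′ + e₂`), and `hessian_webTangent_eq_zero` over a straight
  branch (`…ParallelWebsIdentity.webMap`: tangents `e + G_s Je`, `G_z Je + e₂`).
* Part B (class level, at a sonic web point `W = Γ s + n₀ν_Γ s + z e₂`, hypotheses = the conjuncts of `stub_Q4sonic*` used by `sonic_web_point_hot`):
  `sonic_web_point_eq` (`U₂(−1,W) = U₂(−1,0)`); ★ `sonic_web_point_timeTimePin` (**`σ∂ₜ²U₂(−1,W) ≤ 3|N|/4`**, `…FlatRidgeMixedPin.timeTimePin_of_hotPoint`);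
  `sonic_web_point_mixedPin` (a null direction `T` of the slice Hessian at `W` ⇒ `D(∂ₜU₂(−1,·))(W)T = 0`); ★ `sonic_web_point_curl_eq_zero`
  (**`curl U(−1)(W) = 0`** on the slope slab: poloidal + slab slope law + gradient pin); ★ `sonic_web_point_pressure` (**`σ(∇P(−1,·))(W)₂ = σΔU₂(−1,·)(W) − |N|/2
  ≤ −|N|/2 < 0`** for every classical pressure, `…TwistingTHHotPointPins.gradient_pressure_two_of_hotPoint` + `laplacianPin_of_hotPoint`).
* Part C (the sheet): `sonic_sheet_hessian_tangent_eq_zero` / `sonic_sheet_timeDeriv_tangent_eq_zero` — for a differentiable web function `G` near `p = (s,z)`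
  whose web points carry the ridge height (`σU₂(−1,W q) = R(0,q₂)` near `p`), every sheet tangent is in the kernel of `D²U₂(−1,·)(W p)` and of
  `D(∂ₜU₂(−1,·))(W p)` (the time pin `∂ₜU₂ = N/2` is constant along the sheet).

WHAT THIS IS NOT: not a claim about Navier–Stokes regularity — necessary conditions on the hypothetical hot null sheet of the residual research slots
`stub_Q4sonicLineNeg` / `stub_Q4sonicCurved` (registry twist_split v11); no stub is closed here; items 20428 / 19708 / 27893 OPEN.
-/

noncomputable section

set_option linter.dupNamespace false
set_option linter.style.longLine false

namespace Summit.NavierStokesRegularity.NavierStokesRegularity.Theorems.PoloidalWindowDoorLrcModEntireQ4SonicHotSheetSecondPins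

open Set Function Filter Topology Metric
open scoped RealInnerProductSpace InnerProductSpace Laplacian ContDiff
open Literature.Analysis Literature.Analysis.FluidPDE Literature.Analysis.UnboundedOperators
open Summit.NavierStokesRegularity.NavierStokesRegularity.Theorems
open Summit.NavierStokesRegularity.NavierStokesRegularity.Theorems.LocalSineTubeDoorProfileAlignedWindowRigidityAncient
open Summit.NavierStokesRegularity.NavierStokesRegularity.Theorems.PoloidalWindowDoorLrcModEntireRidgeWiring
open Summit.NavierStokesRegularity.NavierStokesRegularity.Theorems.PoloidalWindowDoorLrcModEntireQ4SonicHotSheet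
open Summit.NavierStokesRegularity.NavierStokesRegularity.Theorems.PoloidalWindowDoorLrcModEntireTwistingTHFlatRidgeMixedPin
open Summit.NavierStokesRegularity.NavierStokesRegularity.Theorems.PoloidalWindowDoorLrcModEntireTwistingTHHotPointPins
open Summit.NavierStokesRegularity.NavierStokesRegularity.Theorems.PoloidalWindowDoorLrcModEntireSheetFlattenTools
open Summit.NavierStokesRegularity.NavierStokesRegularity.Theorems.PoloidalWindowDoorLrcModEntireParallelWebsIdentity
open Summit.NavierStokesRegularity.NavierStokesRegularity.Theorems.PoloidalWindowDoorLrcModEntireRidgeGlobalBranchFrame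
open Summit.NavierStokesRegularity.NavierStokesRegularity.Theorems.PoloidalWindowDoorLrcModEntireCurvedWebHuygens

/-! ### Part A — class-free: the Hessian at a sheet of critical points / of maxima kills the sheet tangents -/

section classfree

variable {E P : Type*} [NormedAddCommGroup E] [NormedSpace ℝ E] [NormedAddCommGroup P] [NormedSpace ℝ P]

/-- If `Dθ(W q) = 0` for all `q` near `p`, `W` is differentiable at `p` and `Dθ` at `W p`, then `D²θ(W p)[DW(p)h] = 0` (chain rule on the constant map
`q ↦ Dθ(W q)`). -/
theorem fderiv_fderiv_apply_eq_zero_of_critical_sheet {θ : E → ℝ} {W : P → E} {p : P} (hW : DifferentiableAt ℝ W p)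
    (hθ : DifferentiableAt ℝ (fderiv ℝ θ) (W p)) (hcrit : ∀ᶠ q in 𝓝 p, fderiv ℝ θ (W q) = 0) (h : P) :
    fderiv ℝ (fderiv ℝ θ) (W p) (fderiv ℝ W p h) = 0 := by
  have hcomp : HasFDerivAt (fun q => fderiv ℝ θ (W q)) ((fderiv ℝ (fderiv ℝ θ) (W p)).comp (fderiv ℝ W p)) p :=
    hθ.hasFDerivAt.comp p hW.hasFDerivAt
  have hzero : fderiv ℝ (fun q => fderiv ℝ θ (W q)) p = 0 := by
    have hev : (fun q => fderiv ℝ θ (W q)) =ᶠ[𝓝 p] fun _ => (0 : E →L[ℝ] ℝ) := hcrit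
    rw [hev.fderiv_eq]; simp
  have h2 := hcomp.fderiv
  rw [hzero] at h2
  have h3 := congrArg (fun L : P →L[ℝ] E →L[ℝ] ℝ => L h) h2
  simpa using h3.symm

/-- A function bounded above by `M` has a local maximum wherever it takes the value `M`. -/
theorem isLocalMax_of_le_of_eq {X : Type*} [TopologicalSpace X] {θ : X → ℝ} {M : ℝ} (hle : ∀ x, θ x ≤ M) {y : X} (hy : θ y = M) :
    IsLocalMax θ y :=
  Filter.Eventually.of_forall fun x => by rw [hy]; exact hle x

/-- Second derivatives scale: `D²(c·θ)(y)[u,w] = c·D²θ(y)[u,w]` for `θ ∈ C²`. -/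
theorem fderiv_fderiv_const_mul_apply {θ : E → ℝ} (hθ : ContDiff ℝ 2 θ) (c : ℝ) (y u w : E) :
    fderiv ℝ (fderiv ℝ (fun x => c * θ x)) y u w = c * fderiv ℝ (fderiv ℝ θ) y u w := by
  rw [fderiv_fderiv_eq_coord (contDiff_const.mul hθ) y u w, fderiv_fderiv_eq_coord hθ y u w]
  have hθd : Differentiable ℝ θ := hθ.differentiable (by norm_num)
  have hDw : Differentiable ℝ (fun x => fderiv ℝ θ x w) :=
    ((hθ.fderiv_right (m := 1) (by norm_num)).differentiable one_ne_zero).clm_apply (differentiable_const w)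
  have h1 : (fun x => fderiv ℝ (fun x' => c * θ x') x w) = fun x => c * fderiv ℝ θ x w := by
    funext x
    rw [((hθd x).hasFDerivAt.const_mul c).fderiv]
    simp [smul_eq_mul]
  rw [h1, ((hDw y).hasFDerivAt.const_mul c).fderiv]
  simp [smul_eq_mul]

/-- **The Hessian of a `C²` function at a sheet of maxima kills the sheet tangents (both slots):** `θ ≤ M` everywhere, `θ(W q) = M` for `q` near `p`,
`W` differentiable at `p` ⇒ `D²θ(W p)[DW(p)h, w] = 0 = D²θ(W p)[w, DW(p)h]`. -/
theorem hessian_sheetTangent_eq_zero {θ : E → ℝ} (hθ : ContDiff ℝ 2 θ) {M : ℝ} (hle : ∀ x, θ x ≤ M) {W : P → E} {p : P}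
    (hW : DifferentiableAt ℝ W p) (hsheet : ∀ᶠ q in 𝓝 p, θ (W q) = M) (h : P) (w : E) :
    fderiv ℝ (fderiv ℝ θ) (W p) (fderiv ℝ W p h) w = 0 ∧ fderiv ℝ (fderiv ℝ θ) (W p) w (fderiv ℝ W p h) = 0 := by
  have hDd : Differentiable ℝ (fderiv ℝ θ) := (hθ.fderiv_right (m := 1) (by norm_num)).differentiable one_ne_zero
  have hcrit : ∀ᶠ q in 𝓝 p, fderiv ℝ θ (W q) = 0 := by
    filter_upwards [hsheet] with q hq using (isLocalMax_of_le_of_eq hle hq).fderiv_eq_zero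
  have h1 : fderiv ℝ (fderiv ℝ θ) (W p) (fderiv ℝ W p h) w = 0 := by
    rw [fderiv_fderiv_apply_eq_zero_of_critical_sheet hW (hDd _) hcrit h]; rfl
  have hsym : fderiv ℝ (fderiv ℝ θ) (W p) w (fderiv ℝ W p h) = fderiv ℝ (fderiv ℝ θ) (W p) (fderiv ℝ W p h) w :=
    (hθ.contDiffAt.isSymmSndFDerivAt (by simp)) w (fderiv ℝ W p h)
  exact ⟨h1, by rw [hsym, h1]⟩

end classfree

/-- **Straight branch:** along the web map `W(s,z) = s·e + G(s,z)·Je + z·e₂` of a function `θ ≤ M` with `θ ∘ W ≡ M` near `p`, the Hessian `D²θ(W p)` kills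
`h₁·e + DG(p)h·Je + h₂·e₂` for every `h` (tangents `e + G_s Je` and `G_z Je + e₂`). -/
theorem hessian_webTangent_eq_zero {θ : EuclideanSpace ℝ (Fin 3) → ℝ} (hθ : ContDiff ℝ 2 θ) {M : ℝ} (hle : ∀ x, θ x ≤ M)
    (e : EuclideanSpace ℝ (Fin 3)) {G : ℝ × ℝ → ℝ} {p : ℝ × ℝ} (hG : DifferentiableAt ℝ G p)
    (hsheet : ∀ᶠ q in 𝓝 p, θ (webMap e G q) = M) (h : ℝ × ℝ) (w : EuclideanSpace ℝ (Fin 3)) :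
    fderiv ℝ (fderiv ℝ θ) (webMap e G p) (h.1 • e + fderiv ℝ G p h • Jvec e + h.2 • e2) w = 0 ∧
      fderiv ℝ (fderiv ℝ θ) (webMap e G p) w (h.1 • e + fderiv ℝ G p h • Jvec e + h.2 • e2) = 0 := by
  rw [← fderiv_webMap_apply e hG h]
  exact hessian_sheetTangent_eq_zero hθ hle (hasFDerivAt_webMap e hG).differentiableAt hsheet h w

section curved

variable {Γ : ℝ → EuclideanSpace ℝ (Fin 3)} {k : ℝ → ℝ} {G : ℝ × ℝ → ℝ}

/-- **Curved branch (Fermi frame of K2-p2's `…CurvedWebHuygens`):** along `W(s,z) = Γ(s) + G(s,z)·JΓ′(s) + z·e₂` of a function `θ ≤ M` with `θ ∘ W ≡ M`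
near `p`, the Hessian `D²θ(W p)` kills `h₁(1 − k(s)G)·Γ′(s) + DG(p)h·JΓ′(s) + h₂·e₂` for every `h`. -/
theorem hessian_curvedWebTangent_eq_zero (hΓ : ContDiff ℝ 2 Γ) (hpl : ∀ s, Γ s 2 = 0)
    (hk : ∀ s, deriv (deriv Γ) s = k s • rotJ (deriv Γ s)) {p : ℝ × ℝ} (hG : DifferentiableAt ℝ G p)
    {θ : EuclideanSpace ℝ (Fin 3) → ℝ} (hθ : ContDiff ℝ 2 θ) {M : ℝ} (hle : ∀ x, θ x ≤ M)
    (hsheet : ∀ᶠ q in 𝓝 p, θ (Γ q.1 + G q • rotJ (deriv Γ q.1) + q.2 • e2) = M) (h : ℝ × ℝ) (w : EuclideanSpace ℝ (Fin 3)) :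
    fderiv ℝ (fderiv ℝ θ) (Γ p.1 + G p • rotJ (deriv Γ p.1) + p.2 • e2)
        ((h.1 * (1 - k p.1 * G p)) • deriv Γ p.1 + fderiv ℝ G p h • rotJ (deriv Γ p.1) + h.2 • e2) w = 0 ∧
      fderiv ℝ (fderiv ℝ θ) (Γ p.1 + G p • rotJ (deriv Γ p.1) + p.2 • e2) w
        ((h.1 * (1 - k p.1 * G p)) • deriv Γ p.1 + fderiv ℝ G p h • rotJ (deriv Γ p.1) + h.2 • e2) = 0 := by
  rw [← fderiv_curvedWeb_apply hΓ hpl hk hG h]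
  exact hessian_sheetTangent_eq_zero (W := fun q : ℝ × ℝ => Γ q.1 + G q • rotJ (deriv Γ q.1) + q.2 • e2) hθ hle
    (differentiableAt_curvedWeb hΓ hpl hk hG) hsheet h w

end curved

/-! ### Part B — class level: the pins at a sonic web point -/

variable {C : ℝ} {U : ℝ → EuclideanSpace ℝ (Fin 3) → EuclideanSpace ℝ (Fin 3)} {Γ νΓ : ℝ → EuclideanSpace ℝ (Fin 3)} {R : ℝ → ℝ → ℝ}
  {σ r δ : ℝ}

/-- `σ ≠ 0` from `σ = ±1`. -/
theorem sigma_ne_zero (hσ : σ = 1 ∨ σ = -1) : σ ≠ 0 := by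
  rcases hσ with h | h <;> rw [h] <;> norm_num

/-- **A sonic web point is a hot point (unsigned form):** `U₂(−1,W) = U₂(−1,0)`. -/
theorem sonic_web_point_eq
    (hUhotbd : ∀ t < 0, ∀ x, Real.sqrt (-t) * |U t x 2| ≤ |U (-1) 0 2|)
    (hσ : σ = 1 ∨ σ = -1) (hσN : σ * U (-1) 0 2 = |U (-1) 0 2|) (hΓhot : ∀ s, U (-1) (Γ s) 2 = U (-1) 0 2)
    (hr : 0 < r) (hδ : 0 < δ)
    (hweb : ∀ z₀ : ℝ, |z₀| < δ → ∀ s₀ : ℝ, ∃ n₀ ∈ Ioo (-r) r,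
      σ * U (-1) (Γ s₀ + n₀ • νΓ s₀ + z₀ • EuclideanSpace.single 2 (1 : ℝ)) 2 = R 0 z₀ ∧
      (∀ n ∈ Icc (-r) r, n ≠ n₀ → σ * U (-1) (Γ s₀ + n • νΓ s₀ + z₀ • EuclideanSpace.single 2 (1 : ℝ)) 2 < R 0 z₀))
    (hson : ∃ a b : ℝ, ∀ z : ℝ, |z| < δ → R 0 z = a + b * z) {z : ℝ} (hz : |z| < δ) (s : ℝ) {n₀ : ℝ}
    (hn₀ : σ * U (-1) (Γ s + n₀ • νΓ s + z • EuclideanSpace.single 2 (1 : ℝ)) 2 = R 0 z) :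
    U (-1) (Γ s + n₀ • νΓ s + z • EuclideanSpace.single 2 (1 : ℝ)) 2 = U (-1) 0 2 := by
  have h := (sonic_web_point_hot hUhotbd hσ hσN hΓhot hr hδ hweb hson hz s hn₀).1
  rw [← hσN] at h
  exact mul_left_cancel₀ (sigma_ne_zero hσ) h

/-- ★ **TIME–TIME PIN at every sonic web point:** `σ·∂ₜ²U₂(−1,W) ≤ 3|N|/4` (`…FlatRidgeMixedPin.timeTimePin_of_hotPoint` at the hot point `W`). -/
theorem sonic_web_point_timeTimePin (hUrate : HasTypeITimeDecay C U) (hUcont : ContinuousOn (uncurry U) (Iio (0 : ℝ) ×ˢ univ))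
    (hUmild : ∀ s t : ℝ, s < t → t < 0 → ∀ x, U t x = heatExtension (U s) (t - s) x - oseenDuhamel 1 s U U t x)
    (hUne : U (-1) 0 2 ≠ 0) (hUhotbd : ∀ t < 0, ∀ x, Real.sqrt (-t) * |U t x 2| ≤ |U (-1) 0 2|)
    (hσ : σ = 1 ∨ σ = -1) (hσN : σ * U (-1) 0 2 = |U (-1) 0 2|) (hΓhot : ∀ s, U (-1) (Γ s) 2 = U (-1) 0 2)
    (hr : 0 < r) (hδ : 0 < δ)
    (hweb : ∀ z₀ : ℝ, |z₀| < δ → ∀ s₀ : ℝ, ∃ n₀ ∈ Ioo (-r) r,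
      σ * U (-1) (Γ s₀ + n₀ • νΓ s₀ + z₀ • EuclideanSpace.single 2 (1 : ℝ)) 2 = R 0 z₀ ∧
      (∀ n ∈ Icc (-r) r, n ≠ n₀ → σ * U (-1) (Γ s₀ + n • νΓ s₀ + z₀ • EuclideanSpace.single 2 (1 : ℝ)) 2 < R 0 z₀))
    (hson : ∃ a b : ℝ, ∀ z : ℝ, |z| < δ → R 0 z = a + b * z) {z : ℝ} (hz : |z| < δ) (s : ℝ) {n₀ : ℝ}
    (hn₀ : σ * U (-1) (Γ s + n₀ • νΓ s + z • EuclideanSpace.single 2 (1 : ℝ)) 2 = R 0 z) :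
    σ * deriv (deriv (fun t => U t (Γ s + n₀ • νΓ s + z • EuclideanSpace.single 2 (1 : ℝ)) 2)) (-1) ≤ 3 * |U (-1) 0 2| / 4 :=
  timeTimePin_of_hotPoint hUrate hUcont hUmild hUne hUhotbd hσN (sonic_web_point_eq hUhotbd hσ hσN hΓhot hr hδ hweb hson hz s hn₀)

/-- **MIXED TIME PIN along a null direction at a sonic web point:** if the slice Hessian of `σU₂(−1,·)` at `W` vanishes on `(T,T)` then
`D(∂ₜU₂(−1,·))(W) T = 0` (`…FlatRidgeMixedPin.fderiv_timeDeriv_two_eq_zero_of_hessian_null`). -/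
theorem sonic_web_point_mixedPin (hUrate : HasTypeITimeDecay C U) (hUcont : ContinuousOn (uncurry U) (Iio (0 : ℝ) ×ˢ univ))
    (hUmild : ∀ s t : ℝ, s < t → t < 0 → ∀ x, U t x = heatExtension (U s) (t - s) x - oseenDuhamel 1 s U U t x)
    (hUne : U (-1) 0 2 ≠ 0) (hUhotbd : ∀ t < 0, ∀ x, Real.sqrt (-t) * |U t x 2| ≤ |U (-1) 0 2|)
    (hσ : σ = 1 ∨ σ = -1) (hσN : σ * U (-1) 0 2 = |U (-1) 0 2|) (hΓhot : ∀ s, U (-1) (Γ s) 2 = U (-1) 0 2)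
    (hr : 0 < r) (hδ : 0 < δ)
    (hweb : ∀ z₀ : ℝ, |z₀| < δ → ∀ s₀ : ℝ, ∃ n₀ ∈ Ioo (-r) r,
      σ * U (-1) (Γ s₀ + n₀ • νΓ s₀ + z₀ • EuclideanSpace.single 2 (1 : ℝ)) 2 = R 0 z₀ ∧
      (∀ n ∈ Icc (-r) r, n ≠ n₀ → σ * U (-1) (Γ s₀ + n • νΓ s₀ + z₀ • EuclideanSpace.single 2 (1 : ℝ)) 2 < R 0 z₀))
    (hson : ∃ a b : ℝ, ∀ z : ℝ, |z| < δ → R 0 z = a + b * z) {z : ℝ} (hz : |z| < δ) (s : ℝ) {n₀ : ℝ}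
    (hn₀ : σ * U (-1) (Γ s + n₀ • νΓ s + z • EuclideanSpace.single 2 (1 : ℝ)) 2 = R 0 z)
    {T : EuclideanSpace ℝ (Fin 3)}
    (hnull : fderiv ℝ (fderiv ℝ (fun x => σ * U (-1) x 2)) (Γ s + n₀ • νΓ s + z • EuclideanSpace.single 2 (1 : ℝ)) T T = 0) :
    fderiv ℝ (fun x => deriv (fun t => U t x 2) (-1)) (Γ s + n₀ • νΓ s + z • EuclideanSpace.single 2 (1 : ℝ)) T = 0 :=
  fderiv_timeDeriv_two_eq_zero_of_hessian_null hUrate hUcont hUmild hUne hUhotbd hσN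
    (sonic_web_point_eq hUhotbd hσ hσN hΓhot hr hδ hweb hson hz s hn₀) hnull

/-- ★ **VANISHING VORTICITY at every sonic web point of the slope slab:** `curl U(−1)(W) = 0` — the vertical component by poloidality, the horizontal
components `∂₁U₂ − ∂₂U₁`, `∂₂U₀ − ∂₀U₂` by the gradient pin `∇U₂(−1,W) = 0` and the slab slope law `∂₂U_b = μ·∂_bU₂` (`b ≠ 2`, `|W₂| = |z| < ρ`). -/
theorem sonic_web_point_curl_eq_zero (hUrate : HasTypeITimeDecay C U) (hUcont : ContinuousOn (uncurry U) (Iio (0 : ℝ) ×ˢ univ))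
    (hUmild : ∀ s t : ℝ, s < t → t < 0 → ∀ x, U t x = heatExtension (U s) (t - s) x - oseenDuhamel 1 s U U t x)
    (hUdiv : ∀ t < 0, VectorCalculus.IsDivFree (U t))
    (hUpol : ∀ s < 0, ∀ q, ⟪curl (U s) q, EuclideanSpace.single 2 1⟫_ℝ = 0)
    (hUhotbd : ∀ t < 0, ∀ x, Real.sqrt (-t) * |U t x 2| ≤ |U (-1) 0 2|)
    (hσ : σ = 1 ∨ σ = -1) (hσN : σ * U (-1) 0 2 = |U (-1) 0 2|)
    (hΓ2 : ∀ s, Γ s 2 = 0) (hΓhot : ∀ s, U (-1) (Γ s) 2 = U (-1) 0 2)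
    (hν : ∀ s, νΓ s = WithLp.toLp 2 ![-(deriv Γ s 1), deriv Γ s 0, 0])
    (hr : 0 < r) (hδ : 0 < δ)
    (hweb : ∀ z₀ : ℝ, |z₀| < δ → ∀ s₀ : ℝ, ∃ n₀ ∈ Ioo (-r) r,
      σ * U (-1) (Γ s₀ + n₀ • νΓ s₀ + z₀ • EuclideanSpace.single 2 (1 : ℝ)) 2 = R 0 z₀ ∧
      (∀ n ∈ Icc (-r) r, n ≠ n₀ → σ * U (-1) (Γ s₀ + n • νΓ s₀ + z₀ • EuclideanSpace.single 2 (1 : ℝ)) 2 < R 0 z₀))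
    {ρ : ℝ} {μ : ℝ → ℝ → ℝ} (hρ : 0 < ρ)
    (hslabU : ∀ t : ℝ, |t + 1| < ρ → ∀ x : EuclideanSpace ℝ (Fin 3), |x 2| < ρ → ∀ b : Fin 3, b ≠ 2 →
      fderiv ℝ (U t) x (EuclideanSpace.single 2 1) b = μ t (x 2) * fderiv ℝ (U t) x (EuclideanSpace.single b 1) 2)
    (hson : ∃ a b : ℝ, ∀ z : ℝ, |z| < δ → R 0 z = a + b * z) {z : ℝ} (hz : |z| < δ) (hzρ : |z| < ρ) (s : ℝ) {n₀ : ℝ}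
    (hn₀ : σ * U (-1) (Γ s + n₀ • νΓ s + z • EuclideanSpace.single 2 (1 : ℝ)) 2 = R 0 z) :
    curl (U (-1)) (Γ s + n₀ • νΓ s + z • EuclideanSpace.single 2 (1 : ℝ)) = 0 := by
  set W : EuclideanSpace ℝ (Fin 3) := Γ s + n₀ • νΓ s + z • EuclideanSpace.single 2 (1 : ℝ) with hW
  have hm1 : (-1 : ℝ) < 0 := by norm_num
  have hy : U (-1) W 2 = U (-1) 0 2 := sonic_web_point_eq hUhotbd hσ hσN hΓhot hr hδ hweb hson hz s hn₀
  -- the gradient pin at the hot point `W`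
  have hgrad : ∀ h : EuclideanSpace ℝ (Fin 3), fderiv ℝ (U (-1)) W h 2 = 0 :=
    fun h => gradPin_of_hotPoint hUrate hUcont hUmild hUdiv hUhotbd hy h
  -- the height of `W` is `z`
  have hW2 : W 2 = z := by
    simp [hW, hΓ2 s, hν s]
  -- the slab slope law at `W`
  have hslope : ∀ b : Fin 3, b ≠ 2 → fderiv ℝ (U (-1)) W (EuclideanSpace.single 2 1) b = 0 := by
    intro b hb
    rw [hslabU (-1) (by simp [hρ]) W (by rw [hW2]; exact hzρ) b hb, hgrad, mul_zero]
  have h0 : curl (U (-1)) W 0 = 0 := by simp [curl, hgrad, hslope 1 (by decide)]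
  have h1 : curl (U (-1)) W 1 = 0 := by simp [curl, hgrad, hslope 0 (by decide)]
  have h2 : curl (U (-1)) W 2 = 0 := by
    have h := hUpol (-1) hm1 W
    rw [EuclideanSpace.inner_single_right] at h
    simpa using h
  ext i
  rw [PiLp.zero_apply]
  fin_cases i
  exacts [h0, h1, h2]

/-- ★ **SIGNED VERTICAL PRESSURE GRADIENT at every sonic web point:** for every classical pressure `P` of the hull element on `t < 0`,
`σ·(∇P(−1,·))(W)₂ = σ·ΔU₂(−1,·)(W) − |N|/2` and `σ·ΔU₂(−1,·)(W) ≤ 0`, hence `σ·(∇P(−1,·))(W)₂ ≤ −|N|/2 < 0`: on the whole hot sheet the pressure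
pushes against `σ` (`…TwistingTHHotPointPins.gradient_pressure_two_of_hotPoint`, `laplacianPin_of_hotPoint`). -/
theorem sonic_web_point_pressure (hUrate : HasTypeITimeDecay C U) (hUcont : ContinuousOn (uncurry U) (Iio (0 : ℝ) ×ˢ univ))
    (hUmild : ∀ s t : ℝ, s < t → t < 0 → ∀ x, U t x = heatExtension (U s) (t - s) x - oseenDuhamel 1 s U U t x)
    (hUdiv : ∀ t < 0, VectorCalculus.IsDivFree (U t))
    (hUne : U (-1) 0 2 ≠ 0) (hUhotbd : ∀ t < 0, ∀ x, Real.sqrt (-t) * |U t x 2| ≤ |U (-1) 0 2|)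
    (hσ : σ = 1 ∨ σ = -1) (hσN : σ * U (-1) 0 2 = |U (-1) 0 2|) (hΓhot : ∀ s, U (-1) (Γ s) 2 = U (-1) 0 2)
    (hr : 0 < r) (hδ : 0 < δ)
    (hweb : ∀ z₀ : ℝ, |z₀| < δ → ∀ s₀ : ℝ, ∃ n₀ ∈ Ioo (-r) r,
      σ * U (-1) (Γ s₀ + n₀ • νΓ s₀ + z₀ • EuclideanSpace.single 2 (1 : ℝ)) 2 = R 0 z₀ ∧
      (∀ n ∈ Icc (-r) r, n ≠ n₀ → σ * U (-1) (Γ s₀ + n • νΓ s₀ + z₀ • EuclideanSpace.single 2 (1 : ℝ)) 2 < R 0 z₀))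
    (hson : ∃ a b : ℝ, ∀ z : ℝ, |z| < δ → R 0 z = a + b * z) {z : ℝ} (hz : |z| < δ) (s : ℝ) {n₀ : ℝ}
    (hn₀ : σ * U (-1) (Γ s + n₀ • νΓ s + z • EuclideanSpace.single 2 (1 : ℝ)) 2 = R 0 z)
    {P : ℝ → EuclideanSpace ℝ (Fin 3) → ℝ} (hP : IsClassicalNSSolutionOn (Iio 0) 1 0 U P) :
    σ * gradient (P (-1)) (Γ s + n₀ • νΓ s + z • EuclideanSpace.single 2 (1 : ℝ)) 2 =
        σ * (Δ (fun w => U (-1) w 2)) (Γ s + n₀ • νΓ s + z • EuclideanSpace.single 2 (1 : ℝ)) - |U (-1) 0 2| / 2 ∧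
      σ * (Δ (fun w => U (-1) w 2)) (Γ s + n₀ • νΓ s + z • EuclideanSpace.single 2 (1 : ℝ)) ≤ 0 ∧
      σ * gradient (P (-1)) (Γ s + n₀ • νΓ s + z • EuclideanSpace.single 2 (1 : ℝ)) 2 ≤ -|U (-1) 0 2| / 2 ∧
      σ * gradient (P (-1)) (Γ s + n₀ • νΓ s + z • EuclideanSpace.single 2 (1 : ℝ)) 2 < 0 := by
  set W : EuclideanSpace ℝ (Fin 3) := Γ s + n₀ • νΓ s + z • EuclideanSpace.single 2 (1 : ℝ) with hW
  have hy : U (-1) W 2 = U (-1) 0 2 := sonic_web_point_eq hUhotbd hσ hσN hΓhot hr hδ hweb hson hz s hn₀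
  have heq := gradient_pressure_two_of_hotPoint hUrate hUcont hUmild hUdiv hUne hUhotbd hy hP
  have hlap := laplacianPin_of_hotPoint hUrate hUcont hUmild hUdiv hUne hUhotbd hy
  have hNpos : 0 < |U (-1) 0 2| := abs_pos.2 hUne
  -- `σΔU₂ ≤ 0` from `N·ΔU₂ ≤ 0` and `σN = |N| > 0`
  have hσlap : σ * (Δ (fun w => U (-1) w 2)) W ≤ 0 := by
    rcases hσ with h | h
    · rw [h, one_mul] at hσN
      rw [h, one_mul]
      have hN : 0 < U (-1) 0 2 := by rw [hσN]; exact hNpos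
      nlinarith [hlap, hN]
    · rw [h, neg_one_mul] at hσN
      rw [h, neg_one_mul]
      have hN : U (-1) 0 2 < 0 := by linarith [hσN, hNpos]
      nlinarith [hlap, hN]
  have h1 : σ * gradient (P (-1)) W 2 = σ * (Δ (fun w => U (-1) w 2)) W - |U (-1) 0 2| / 2 := by
    rw [heq, mul_sub, ← hσN]; ring
  refine ⟨h1, hσlap, by rw [h1]; linarith, by rw [h1]; linarith⟩

/-! ### Part C — the sheet: tangents of the sonic web sheet are null directions of the slice Hessian and of `D(∂ₜU₂(−1,·))` -/

/-- **Sheet tangents are null for the slice Hessian (straight branch, web currency `W = webMap e G`):** in the sonic cell, if a web function `G`,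
differentiable at `p`, carries the ridge height near `p` (`σU₂(−1, W q) = R(0,q₂)` for `q` near `p`, `|p₂| < δ`), then
`D²U₂(−1,·)(W p)[h₁e + DG(p)h·Je + h₂e₂, w] = 0` for all `h`, `w`. -/
theorem sonic_sheet_hessian_tangent_eq_zero (hUrate : HasTypeITimeDecay C U) (hUcont : ContinuousOn (uncurry U) (Iio (0 : ℝ) ×ˢ univ))
    (hUmild : ∀ s t : ℝ, s < t → t < 0 → ∀ x, U t x = heatExtension (U s) (t - s) x - oseenDuhamel 1 s U U t x)
    (hUhotbd : ∀ t < 0, ∀ x, Real.sqrt (-t) * |U t x 2| ≤ |U (-1) 0 2|)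
    (hσ : σ = 1 ∨ σ = -1) (hσN : σ * U (-1) 0 2 = |U (-1) 0 2|) (hΓhot : ∀ s, U (-1) (Γ s) 2 = U (-1) 0 2)
    (hr : 0 < r) (hδ : 0 < δ)
    (hweb : ∀ z₀ : ℝ, |z₀| < δ → ∀ s₀ : ℝ, ∃ n₀ ∈ Ioo (-r) r,
      σ * U (-1) (Γ s₀ + n₀ • νΓ s₀ + z₀ • EuclideanSpace.single 2 (1 : ℝ)) 2 = R 0 z₀ ∧
      (∀ n ∈ Icc (-r) r, n ≠ n₀ → σ * U (-1) (Γ s₀ + n • νΓ s₀ + z₀ • EuclideanSpace.single 2 (1 : ℝ)) 2 < R 0 z₀))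
    (hson : ∃ a b : ℝ, ∀ z : ℝ, |z| < δ → R 0 z = a + b * z)
    (e : EuclideanSpace ℝ (Fin 3)) {G : ℝ × ℝ → ℝ} {p : ℝ × ℝ} (hp : |p.2| < δ) (hG : DifferentiableAt ℝ G p)
    (hGval : ∀ᶠ q in 𝓝 p, σ * U (-1) (webMap e G q) 2 = R 0 q.2) (h : ℝ × ℝ) (w : EuclideanSpace ℝ (Fin 3)) :
    fderiv ℝ (fderiv ℝ (fun x => U (-1) x 2)) (webMap e G p) (h.1 • e + fderiv ℝ G p h • Jvec e + h.2 • e2) w = 0 ∧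
      fderiv ℝ (fderiv ℝ (fun x => σ * U (-1) x 2)) (webMap e G p) (h.1 • e + fderiv ℝ G p h • Jvec e + h.2 • e2)
        (h.1 • e + fderiv ℝ G p h • Jvec e + h.2 • e2) = 0 := by
  have hm1 : (-1 : ℝ) < 0 := by norm_num
  have hσ0 := sigma_ne_zero hσ
  -- regularity of the slice
  have hUan : AnalyticOnNhd ℝ (U (-1)) univ := analyticOnNhd_slice hUcont (bdd_of_hasTypeITimeDecay hUrate) hUmild hm1
  have hθan : AnalyticOnNhd ℝ (fun y => U (-1) y 2) univ := fun x _ =>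
    ((EuclideanSpace.proj (𝕜 := ℝ) (2 : Fin 3)).analyticAt _).comp (hUan x (mem_univ _))
  have hθ2 : ContDiff ℝ 2 (fun y => U (-1) y 2) := hθan.contDiff
  have hF2 : ContDiff ℝ 2 (fun y => σ * U (-1) y 2) := contDiff_const.mul hθ2
  -- the signed component is bounded by `|N|` and equals `|N|` on the sheet near `p`
  have hle : ∀ x, σ * U (-1) x 2 ≤ |U (-1) 0 2| := by
    intro x
    have h1 : σ * U (-1) x 2 ≤ |U (-1) x 2| := by
      rcases hσ with h | h
      · rw [h, one_mul]; exact le_abs_self _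
      · rw [h, neg_one_mul]; exact neg_le_abs _
    have h2 := hUhotbd (-1) hm1 x
    rw [neg_neg, Real.sqrt_one, one_mul] at h2
    exact h1.trans h2
  have hopen : ∀ᶠ q : ℝ × ℝ in 𝓝 p, |q.2| < δ :=
    (isOpen_lt (continuous_abs.comp continuous_snd) continuous_const).mem_nhds hp
  have hsheet : ∀ᶠ q in 𝓝 p, σ * U (-1) (webMap e G q) 2 = |U (-1) 0 2| := by
    filter_upwards [hGval, hopen] with q hq hq2
    rw [hq, sonic_ridge_height_const hUhotbd hσ hσN hΓhot hr hδ hweb hson q.2 hq2]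
  have hS := hessian_webTangent_eq_zero hF2 hle e hG hsheet h
  refine ⟨?_, (hS _).1⟩
  -- divide the signed statement by `σ`
  have h1 := (hS w).1
  rw [fderiv_fderiv_const_mul_apply hθ2 σ] at h1
  exact (mul_eq_zero.1 h1).resolve_left hσ0

/-- **Sheet tangents are null for `D(∂ₜU₂(−1,·))` (straight branch, web currency):** under the same hypotheses plus the class data of the hull
element, `D(∂ₜU₂(−1,·))(W p)[h₁e + DG(p)h·Je + h₂e₂] = 0` for every `h` — the time pin `∂ₜU₂ = N/2` holds at every sheet point, and the mixed pin
`…FlatRidgeMixedPin.fderiv_timeDeriv_two_eq_zero_of_hessian_null` turns the null direction of the slice Hessian into a critical direction of `∂ₜU₂(−1,·)`. -/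
theorem sonic_sheet_timeDeriv_tangent_eq_zero (hUrate : HasTypeITimeDecay C U) (hUcont : ContinuousOn (uncurry U) (Iio (0 : ℝ) ×ˢ univ))
    (hUmild : ∀ s t : ℝ, s < t → t < 0 → ∀ x, U t x = heatExtension (U s) (t - s) x - oseenDuhamel 1 s U U t x)
    (hUne : U (-1) 0 2 ≠ 0) (hUhotbd : ∀ t < 0, ∀ x, Real.sqrt (-t) * |U t x 2| ≤ |U (-1) 0 2|)
    (hσ : σ = 1 ∨ σ = -1) (hσN : σ * U (-1) 0 2 = |U (-1) 0 2|) (hΓhot : ∀ s, U (-1) (Γ s) 2 = U (-1) 0 2)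
    (hr : 0 < r) (hδ : 0 < δ)
    (hweb : ∀ z₀ : ℝ, |z₀| < δ → ∀ s₀ : ℝ, ∃ n₀ ∈ Ioo (-r) r,
      σ * U (-1) (Γ s₀ + n₀ • νΓ s₀ + z₀ • EuclideanSpace.single 2 (1 : ℝ)) 2 = R 0 z₀ ∧
      (∀ n ∈ Icc (-r) r, n ≠ n₀ → σ * U (-1) (Γ s₀ + n • νΓ s₀ + z₀ • EuclideanSpace.single 2 (1 : ℝ)) 2 < R 0 z₀))
    (hson : ∃ a b : ℝ, ∀ z : ℝ, |z| < δ → R 0 z = a + b * z)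
    (e : EuclideanSpace ℝ (Fin 3)) {G : ℝ × ℝ → ℝ} {p : ℝ × ℝ} (hp : |p.2| < δ) (hG : DifferentiableAt ℝ G p)
    (hGval : ∀ᶠ q in 𝓝 p, σ * U (-1) (webMap e G q) 2 = R 0 q.2) (h : ℝ × ℝ) :
    fderiv ℝ (fun x => deriv (fun t => U t x 2) (-1)) (webMap e G p) (h.1 • e + fderiv ℝ G p h • Jvec e + h.2 • e2) = 0 := by
  have hσ0 := sigma_ne_zero hσ
  -- the base point of the sheet is a hot point
  have hval : σ * U (-1) (webMap e G p) 2 = |U (-1) 0 2| := by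
    rw [hGval.self_of_nhds, sonic_ridge_height_const hUhotbd hσ hσN hΓhot hr hδ hweb hson p.2 hp]
  have hy : U (-1) (webMap e G p) 2 = U (-1) 0 2 := by
    rw [← hσN] at hval
    exact mul_left_cancel₀ hσ0 hval
  -- the tangent is a null direction of the signed slice Hessian
  have hnull := (sonic_sheet_hessian_tangent_eq_zero hUrate hUcont hUmild hUhotbd hσ hσN hΓhot hr hδ hweb hson e hp hG hGval h
    (h.1 • e + fderiv ℝ G p h • Jvec e + h.2 • e2)).2
  exact fderiv_timeDeriv_two_eq_zero_of_hessian_null hUrate hUcont hUmild hUne hUhotbd hσN hy hnull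

end Summit.NavierStokesRegularity.NavierStokesRegularity.Theorems.PoloidalWindowDoorLrcModEntireQ4SonicHotSheetSecondPins

end
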